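import Literature.Probability.LatticeModels.BalabanStepOneFormatPolymer

/-!
# Balaban's step-one format — polymer combinatorics, part 2: collapse of the gas, bond factorisation

Continuation of `BalabanStepOneFormatPolymer`:

* `sum_adm_prod_eq_prod_canon` — for activities vanishing off connected collar-closed polymers, the
  polymer gas `Σ_{Ps ∈ Adm Ω} Π_{P ∈ Ps} g P` of `StepOneFormat` collapses to the single product over the
  canonical family `canon Ω` (uniqueness `adm_eq_canon`); `prod_canon_eq_prod_comps` re-indexes that
  product by the classes; `canon_spec` lists what a canonical polymer satisfies;
* bonds `(s, i) ↦ {s, s + eᵢ}` (`Touch`): a bond touches at most one class and touches `Ω` iff it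
  touches a class, so bond products over the bonds touching `Ω` factor over the classes
  (`prod_filter_touch_eq_prod_comps`);
* `isConn_image_add_iff` — connectedness of a polymer is translation invariant (graph automorphism).

Folklore; no fact about any engine is asserted.
-/

noncomputable section

open scoped BigOperators Classical
open Finset

namespace Literature.Probability.LatticeModels.BalabanStepOne

variable {L' M : ℕ}

section canon

variable [NeZero L'] [NeZero M]


/-- **Collapse of the polymer gas.** If the activities vanish on every polymer meeting `Ω` that is not
both connected and collar-closed, the gas over admissible families is the single product over the
canonical family. [folklore] -/
theorem sum_adm_prod_eq_prod_canon {β : Type*} [CommSemiring β] (Ω : Finset (Site L' M))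
    (g : Finset (Site L' M) → β)
    (hg : ∀ P, (P ∩ Ω).Nonempty → ¬ (IsConn P ∧ P = collar (P ∩ Ω)) → g P = 0) :
    ∑ Ps ∈ univ.filter (fun Ps : Finset (Finset (Site L' M)) => Adm Ω Ps), ∏ P ∈ Ps, g P =
      ∏ P ∈ canon Ω, g P := by
  rw [sum_eq_single (canon Ω)]
  · intro Ps hPs hne
    have hAdm : Adm Ω Ps := (mem_filter.1 hPs).2
    by_contra hprod
    refine hne (adm_eq_canon hAdm fun P hP => ?_)
    by_contra hbad
    exact hprod (prod_eq_zero hP (hg P (hAdm.1 P hP) hbad))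
  · intro h
    exact absurd (mem_filter.2 ⟨mem_univ _, adm_canon Ω⟩) h

/-- Re-indexing the canonical product by the classes. [folklore] -/
theorem prod_canon_eq_prod_comps {β : Type*} [CommMonoid β] (Ω : Finset (Site L' M))
    (F : Finset (Site L' M) → β) :
    ∏ P ∈ canon Ω, F P = ∏ D ∈ Ω.image (comp Ω), F (collar D) := by
  have h : canon Ω = (Ω.image (comp Ω)).image collar := by
    rw [image_image]; rfl
  rw [h, prod_image]
  intro D hD D' hD' hDD'
  obtain ⟨x, hx, rfl⟩ := mem_image.1 hD
  obtain ⟨x', hx', rfl⟩ := mem_image.1 hD'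
  rw [← collar_comp_inter Ω x, hDD', collar_comp_inter Ω x']

/-- A canonical polymer is connected, collar-closed and meets `Ω` in a class. [folklore] -/
theorem canon_spec {Ω : Finset (Site L' M)} {x : Site L' M} (hx : x ∈ Ω) :
    IsConn (collar (comp Ω x)) ∧ collar (comp Ω x) ∩ Ω = comp Ω x ∧
      collar (comp Ω x) = collar (collar (comp Ω x) ∩ Ω) ∧ (collar (comp Ω x) ∩ Ω).Nonempty := by
  refine ⟨isConn_collar_comp hx, collar_comp_inter Ω x, by rw [collar_comp_inter Ω x], ?_⟩
  rw [collar_comp_inter Ω x]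
  exact comp_nonempty hx

end canon

/-! ### Bonds -/

/-- A bond `(s, i) ↦ {s, s + eᵢ}` TOUCHES a site set if one of its endpoints lies in it. [folklore] -/
def Touch (D : Finset (Site L' M)) (b : Site L' M × Fin 3) : Prop :=
  b.1 ∈ D ∨ b.1 + dir L' M b.2 ∈ D

/-- A bond touches a set iff its endpoint pair is not disjoint from it. [folklore] -/
theorem touch_iff_not_disjoint (D : Finset (Site L' M)) (b : Site L' M × Fin 3) :
    Touch D b ↔ ¬ Disjoint ({b.1, b.1 + dir L' M b.2} : Finset (Site L' M)) D := by
  unfold Touch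
  rw [not_disjoint_iff]
  simp only [mem_insert, mem_singleton]
  constructor
  · rintro (h | h)
    · exact ⟨_, Or.inl rfl, h⟩
    · exact ⟨_, Or.inr rfl, h⟩
  · rintro ⟨a, rfl | rfl, ha⟩
    · exact Or.inl ha
    · exact Or.inr ha

/-- The two endpoints of a bond are near. [folklore] -/
theorem near_endpoints (b : Site L' M × Fin 3) : Near b.1 (b.1 + dir L' M b.2) :=
  near_add_dir _ _

/-- A bond touches at most one class. [folklore] -/
theorem touch_unique {Ω : Finset (Site L' M)} {x x' : Site L' M} {b : Site L' M × Fin 3}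
    (h : Touch (comp Ω x) b) (h' : Touch (comp Ω x') b) : comp Ω x = comp Ω x' := by
  by_contra hne
  have hn := near_endpoints b
  rcases h with h | h <;> rcases h' with h' | h'
  · exact not_close_of_comp_ne hne h h' (near_refl _).close
  · exact not_close_of_comp_ne hne h h' hn.close
  · exact not_close_of_comp_ne hne h h' hn.symm.close
  · exact not_close_of_comp_ne hne h h' (near_refl _).close

/-- A bond touches `Ω` iff it touches one of its classes. [folklore] -/
theorem touch_iff_exists_comp {Ω : Finset (Site L' M)} {b : Site L' M × Fin 3} :
    Touch Ω b ↔ ∃ D ∈ Ω.image (comp Ω), Touch D b := by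
  constructor
  · rintro (h | h)
    · exact ⟨comp Ω b.1, mem_image_of_mem _ h, Or.inl (mem_comp_self h)⟩
    · exact ⟨comp Ω (b.1 + dir L' M b.2), mem_image_of_mem _ h, Or.inr (mem_comp_self h)⟩
  · rintro ⟨D, hD, h⟩
    obtain ⟨x, -, rfl⟩ := mem_image.1 hD
    exact h.imp (fun h => comp_subset _ _ h) fun h => comp_subset _ _ h

section bondsFintype

variable [NeZero L'] [NeZero M]

/-- The bonds touching `Ω` are the disjoint union over the classes of the bonds touching each class.
[folklore] -/
theorem filter_touch_eq_biUnion (Ω : Finset (Site L' M)) :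
    univ.filter (fun b : Site L' M × Fin 3 => Touch Ω b) =
      (Ω.image (comp Ω)).biUnion fun D => univ.filter fun b => Touch D b := by
  ext b
  simp only [mem_filter, mem_univ, true_and, mem_biUnion]
  exact touch_iff_exists_comp

/-- The bond sets touching distinct classes are pairwise disjoint. [folklore] -/
theorem pairwiseDisjoint_filter_touch (Ω : Finset (Site L' M)) :
    ((Ω.image (comp Ω) : Finset (Finset (Site L' M))) : Set (Finset (Site L' M))).PairwiseDisjoint
      fun D => univ.filter fun b : Site L' M × Fin 3 => Touch D b := by
  intro D hD D' hD' hne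
  obtain ⟨x, -, rfl⟩ := mem_image.1 (mem_coe.1 hD)
  obtain ⟨x', -, rfl⟩ := mem_image.1 (mem_coe.1 hD')
  rw [Function.onFun, disjoint_left]
  intro b hb hb'
  exact hne (touch_unique (mem_filter.1 hb).2 (mem_filter.1 hb').2)

/-- **Factorisation of bond products over the classes.** [folklore] -/
theorem prod_filter_touch_eq_prod_comps {β : Type*} [CommMonoid β] (Ω : Finset (Site L' M))
    (w : Site L' M × Fin 3 → β) :
    ∏ b ∈ univ.filter (fun b : Site L' M × Fin 3 => Touch Ω b), w b =
      ∏ D ∈ Ω.image (comp Ω), ∏ b ∈ univ.filter (fun b : Site L' M × Fin 3 => Touch D b), w b := by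
  rw [filter_touch_eq_biUnion, prod_biUnion (pairwiseDisjoint_filter_touch Ω)]

end bondsFintype


/-! ### Translation covariance of connectedness -/

/-- Translation by `t` is an automorphism of the nearest-neighbour graph. [folklore] -/
def addIso (t : Site L' M) : adjGraph L' M ≃g adjGraph L' M where
  toEquiv := Equiv.addRight t
  map_rel_iff' := by
    intro a b
    simp only [Equiv.coe_addRight, adjGraph_adj, ne_eq, add_right_cancel_iff, add_right_comm _ t]

/-- Connectedness of a polymer is translation invariant. [folklore] -/
theorem isConn_image_add_iff (P : Finset (Site L' M)) (t : Site L' M) :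
    IsConn (P.image (· + t)) ↔ IsConn P := by
  unfold IsConn
  have hbij : Set.BijOn (addIso t) (P : Set (Site L' M)) ((P.image (· + t) : Finset (Site L' M)) : Set _) := by
    refine ⟨?_, ?_, ?_⟩
    · intro x hx
      exact mem_coe.2 (mem_image.2 ⟨x, mem_coe.1 hx, rfl⟩)
    · intro x _ y _ h
      exact add_right_cancel h
    · intro y hy
      obtain ⟨x, hx, rfl⟩ := mem_image.1 (mem_coe.1 hy)
      exact ⟨x, mem_coe.2 hx, rfl⟩
  exact ((addIso t).induce hbij).connected_iff.symm

end Literature.Probability.LatticeModels.BalabanStepOne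

end
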